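import Mathlib

/-!
# No-phase-locking certification on balanced multipartite clique complexes (DEQ-A77)

HONEST FRAMING: instance-level adjudication of specific advantage claims; no claim about
BQP vs BPP or the summit.

Context (cell pub-qadeq, claim A-77 = Leditto, Southwell, Usman, Modi, "Quantum algorithms for
higher-order Kuramoto dynamics", arXiv:2604.20108v1: Task 2, eq. (23); Corollary 2; eq. (27)).
DEQ-A77.md (unit pub-qadeq-deq-1) shows that on the advantage family of their Corollary 2 — the clique
complex of the balanced complete `(k+1)`-partite graph with node-aggregated simplicial data — the
simplicial NPL critical value satisfies `(K^s_{k-1})² = Φ/(k+1)` with `Φ` an explicit weighted sum of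
ANOVA variance components (Theorem A77 (i)), whence an exact `O(n)` evaluation for affine aggregation
functions and a signed pick-freeze Monte Carlo decision procedure with
`N = ⌈2 W² Λ⁴ log(2/δ)/((k+1)² η²)⌉` samples, `W = Σ_{r=1}^{k+1} C(k+1,r) H_r ≤ 2^{k+1} H_{k+1}`, for
bounded black-box aggregation functions (Theorem A77 (iii), Corollary A77), all in the paper's own
node-aggregated input model.  This file proves, sorry-free, the elementary lemmas that carry the
decision procedure and its budget:

* `npl_of_coupling_lt_gap`, `npl_iff_estimate_gt` — the THRESHOLD LEMMA of Corollary A77: under the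
  promise `Δ ≤ |K − K^s|`, either `K < Δ` forces the answer, or any estimate `E` of `(K^s)²` with
  `|E − (K^s)²| ≤ K Δ` decides `K < K^s ↔ K² + Δ² < E`;
* `hoeffding_budget` — the sample count: `N ≥ 2 W² Λ⁴ log(2/δ)/(K² η²)` makes the two-sided Hoeffding
  bound `2 exp(−2 N (K η)²/(2 W Λ²)²)` for means of `[−W Λ², W Λ²]`-valued samples at most `δ`;
* `alternating_choose_div_eq_harmonic` — the identity `Σ_{r=1}^{a} (−1)^{r+1} C(a,r)/r = H_a` that turns
  the variance-component form of `Φ` into the pick-freeze form (Theorem A77 (i), second equality);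
* `weight_le_two_pow_mul_harmonic` — `Σ_{r ≤ K} C(K,r) H_r ≤ 2^K H_K`, the bound on the estimator's range
  constant `W` used for "poly(n) at k = Θ(log n)".

Everything is `[folklore]`-level arithmetic over Mathlib; no named fact, no axiom, no `def`.
Hoeffding's inequality itself and the ANOVA identity (Theorem A77 (i), first equality: projector calculus
for `B_kᵀ B_k = D (Σ_j J^{(j)}) D`) are NOT formalised here; they are proved on paper in DEQ-A77.md §3–§4
and checked numerically by two independent implementations in NUMERICS-A77.md.
-/

namespace Summit.QuantumAdvantage.Dequantization.MultipartiteNPL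

open Finset BigOperators

section Decision

/-- `[folklore]` **Small-coupling branch (Corollary A77).** If `0 ≤ K^s`, the promise `Δ ≤ |K − K^s|`
holds and `K < Δ`, then `K < K^s` (output `z = 1` with no estimation at all). -/
theorem npl_of_coupling_lt_gap {K Ks Δ : ℝ} (hKs : 0 ≤ Ks) (hgap : Δ ≤ |K - Ks|) (hK : K < Δ) :
    K < Ks := by
  by_contra h
  push Not at h
  rw [abs_of_nonneg (by linarith)] at hgap
  linarith

/-- `[folklore]` **Threshold lemma (Corollary A77).** Under the promise `Δ ≤ |K − K^s|` with
`0 < Δ ≤ K` and `0 ≤ K^s`, any estimate `E` of `(K^s)²` with `|E − (K^s)²| ≤ K Δ` decides the task: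
`K < K^s ↔ K² + Δ² < E` (the threshold `K² + Δ²` is at distance `≥ 2 K Δ` from `(K^s)²` on both sides). -/
theorem npl_iff_estimate_gt {K Ks Δ E : ℝ} (hΔ : 0 < Δ) (hKΔ : Δ ≤ K) (hKs : 0 ≤ Ks)
    (hgap : Δ ≤ |K - Ks|) (hE : |E - Ks ^ 2| ≤ K * Δ) :
    K < Ks ↔ K ^ 2 + Δ ^ 2 < E := by
  have hK : 0 < K := lt_of_lt_of_le hΔ hKΔ
  obtain ⟨hE1, hE2⟩ := abs_le.1 hE
  rcases le_or_gt Ks K with h | h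
  · rw [abs_of_nonneg (by linarith)] at hgap
    constructor
    · intro h'
      linarith
    · intro h'
      exfalso
      have h1 : Ks ≤ K - Δ := by linarith
      have h2 : Ks ^ 2 ≤ (K - Δ) ^ 2 := pow_le_pow_left₀ hKs h1 2
      nlinarith
  · rw [abs_of_neg (by linarith)] at hgap
    constructor
    · intro _
      have h1 : K + Δ ≤ Ks := by linarith
      have h2 : (K + Δ) ^ 2 ≤ Ks ^ 2 := pow_le_pow_left₀ (by linarith) h1 2
      nlinarith
    · intro _
      exact h

end Decision

section Budget

/-- `[folklore]` **Sample count (Theorem A77 (iii)).** With `N ≥ 2 W² Λ⁴ log(2/δ)/(K² η²)` i.i.d.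
samples bounded by `W Λ²` in absolute value, the two-sided Hoeffding bound for the deviation `K η` of
their mean, `2 exp(−2 N (K η)² / (2 W Λ²)²)`, is at most `δ`. -/
theorem hoeffding_budget {W Λ K η δ N : ℝ} (hW : 0 < W) (hΛ : 0 < Λ) (hK : 0 < K) (hη : 0 < η)
    (hδ : 0 < δ) (hN : 2 * W ^ 2 * Λ ^ 4 * Real.log (2 / δ) / (K ^ 2 * η ^ 2) ≤ N) :
    2 * Real.exp (-(2 * N * (K * η) ^ 2 / (2 * W * Λ ^ 2) ^ 2)) ≤ δ := by
  have hpos : (0 : ℝ) < 2 / δ := by positivity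
  have hKη : (0 : ℝ) < K ^ 2 * η ^ 2 := by positivity
  have hmul := mul_le_mul_of_nonneg_right hN hKη.le
  have e : 2 * W ^ 2 * Λ ^ 4 * Real.log (2 / δ) / (K ^ 2 * η ^ 2) * (K ^ 2 * η ^ 2)
      = Real.log (2 / δ) * (2 * W ^ 2 * Λ ^ 4) := by
    field_simp
  have h0 : Real.log (2 / δ) * (2 * W ^ 2 * Λ ^ 4) ≤ N * (K ^ 2 * η ^ 2) := by
    rw [e] at hmul
    exact hmul
  have h1 : Real.log (2 / δ) ≤ 2 * N * (K * η) ^ 2 / (2 * W * Λ ^ 2) ^ 2 := by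
    rw [le_div_iff₀ (by positivity)]
    have e2 : Real.log (2 / δ) * (2 * W * Λ ^ 2) ^ 2 = 2 * (Real.log (2 / δ) * (2 * W ^ 2 * Λ ^ 4)) := by
      ring
    have e3 : 2 * N * (K * η) ^ 2 = 2 * (N * (K ^ 2 * η ^ 2)) := by ring
    rw [e2, e3]
    linarith
  calc 2 * Real.exp (-(2 * N * (K * η) ^ 2 / (2 * W * Λ ^ 2) ^ 2))
      ≤ 2 * Real.exp (-Real.log (2 / δ)) := by gcongr
    _ = δ := by
        rw [Real.exp_neg, Real.exp_log hpos]
        field_simp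

end Budget

section Harmonic

/-- `[folklore]` **Alternating binomial–harmonic identity (Theorem A77 (i)).**
`Σ_{r=0}^{a-1} (−1)^r C(a, r+1)/(r+1) = H_a`, i.e. `Σ_{r=1}^{a} (−1)^{r+1} C(a,r)/r = H_a`.
(Induction: Pascal's rule, `C(a,r)/(r+1) = C(a+1,r+1)/(a+1)`, and `Σ_r (−1)^r C(a+1,r) = 0`.) -/
theorem alternating_choose_div_eq_harmonic (a : ℕ) :
    ∑ r ∈ Finset.range a, (-1 : ℚ) ^ r * (a.choose (r + 1) : ℚ) / (r + 1) = harmonic a := by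
  induction a with
  | zero => simp
  | succ a ih =>
    rw [harmonic_succ]
    have hP : ∀ r : ℕ, ((a + 1).choose (r + 1) : ℚ) = (a.choose r : ℚ) + (a.choose (r + 1) : ℚ) := by
      intro r
      rw [Nat.choose_succ_succ']
      push_cast
      ring
    have h1 : ∑ r ∈ Finset.range (a + 1), (-1 : ℚ) ^ r * ((a + 1).choose (r + 1) : ℚ) / (r + 1)
        = ∑ r ∈ Finset.range (a + 1), (-1 : ℚ) ^ r * (a.choose (r + 1) : ℚ) / (r + 1)
          + ∑ r ∈ Finset.range (a + 1), (-1 : ℚ) ^ r * (a.choose r : ℚ) / (r + 1) := by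
      rw [← Finset.sum_add_distrib]
      refine Finset.sum_congr rfl fun r _ => ?_
      rw [hP]
      ring
    have h2 : ∑ r ∈ Finset.range (a + 1), (-1 : ℚ) ^ r * (a.choose (r + 1) : ℚ) / (r + 1)
        = ∑ r ∈ Finset.range a, (-1 : ℚ) ^ r * (a.choose (r + 1) : ℚ) / (r + 1) := by
      rw [Finset.sum_range_succ, Nat.choose_succ_self]
      push_cast
      ring
    have hQ : ∀ r : ℕ, (a.choose r : ℚ) / (r + 1) = ((a + 1).choose (r + 1) : ℚ) / (a + 1) := by
      intro r
      have h := Nat.add_one_mul_choose_eq a r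
      have hc : ((a + 1 : ℕ) : ℚ) * (a.choose r : ℚ) = ((a + 1).choose (r + 1) : ℚ) * ((r + 1 : ℕ) : ℚ) := by
        exact_mod_cast h
      push_cast at hc
      rw [div_eq_div_iff (by positivity) (by positivity)]
      linarith
    have h3 : ∑ r ∈ Finset.range (a + 1), (-1 : ℚ) ^ r * (a.choose r : ℚ) / (r + 1)
        = (∑ r ∈ Finset.range (a + 1), (-1 : ℚ) ^ r * ((a + 1).choose (r + 1) : ℚ)) / (a + 1) := by
      rw [Finset.sum_div]
      refine Finset.sum_congr rfl fun r _ => ?_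
      rw [mul_div_assoc, hQ, ← mul_div_assoc]
    have h4 : ∑ r ∈ Finset.range (a + 1), (-1 : ℚ) ^ r * ((a + 1).choose (r + 1) : ℚ) = 1 := by
      have hz := Int.alternating_sum_range_choose_of_ne (show a + 1 ≠ 0 by omega)
      have h0 : ∑ r ∈ Finset.range (a + 1 + 1), (-1 : ℚ) ^ r * ((a + 1).choose r : ℚ) = 0 := by
        exact_mod_cast hz
      rw [Finset.sum_range_succ'] at h0
      have e : ∑ r ∈ Finset.range (a + 1), (-1 : ℚ) ^ (r + 1) * ((a + 1).choose (r + 1) : ℚ)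
          = -∑ r ∈ Finset.range (a + 1), (-1 : ℚ) ^ r * ((a + 1).choose (r + 1) : ℚ) := by
        rw [← Finset.sum_neg_distrib]
        exact Finset.sum_congr rfl fun r _ => by ring
      have e0 : (-1 : ℚ) ^ 0 * ((a + 1).choose 0 : ℚ) = 1 := by simp
      rw [e, e0] at h0
      linarith
    rw [h1, h2, ih, h3, h4]
    push_cast
    ring

/-- `[folklore]` **Range constant of the signed pick-freeze estimator (Theorem A77 (iii)).**
`Σ_{r=0}^{K} C(K,r) H_r ≤ 2^K H_K` (so `W = Σ_{r=1}^{K} C(K,r) H_r ≤ 2^K H_K`, polynomial in `n` when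
`K = k+1 = Θ(log n)`). -/
theorem weight_le_two_pow_mul_harmonic (K : ℕ) :
    ∑ r ∈ Finset.range (K + 1), (K.choose r : ℚ) * harmonic r ≤ 2 ^ K * harmonic K := by
  have hmono : ∀ r ∈ Finset.range (K + 1),
      (K.choose r : ℚ) * harmonic r ≤ (K.choose r : ℚ) * harmonic K := by
    intro r hr
    have hr' : r ≤ K := Nat.lt_succ_iff.mp (Finset.mem_range.mp hr)
    apply mul_le_mul_of_nonneg_left _ (by positivity)
    simp only [harmonic]
    apply Finset.sum_le_sum_of_subset_of_nonneg (Finset.range_mono hr')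
    intro i _ _
    positivity
  calc ∑ r ∈ Finset.range (K + 1), (K.choose r : ℚ) * harmonic r
      ≤ ∑ r ∈ Finset.range (K + 1), (K.choose r : ℚ) * harmonic K := Finset.sum_le_sum hmono
    _ = (∑ r ∈ Finset.range (K + 1), (K.choose r : ℚ)) * harmonic K := by rw [Finset.sum_mul]
    _ = 2 ^ K * harmonic K := by
        congr 1
        have h := Nat.sum_range_choose K
        exact_mod_cast h

end Harmonic

end Summit.QuantumAdvantage.Dequantization.MultipartiteNPL
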